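import Summits.Schanuel.Schanuel.Theses.DiophantineDichotomy

/-!
# Line `compositum-defect-split` — skeleton for crux `DiophantineDichotomy.EPiSimultaneousType`
# (stmt-Schanuel-6118, route-Schanuel-DiophantineDichotomy, rank 4)

See `Lines/compositum-defect-split.md` (the line card) for the prose: idea, stubs, hardest stub,
barriers, Disproof used, triage answers.

THE CRUX. `∃ a < 1, b, C > 0`: for all `d, H ∈ ℕ`, all `γ = (γ₁, γ₂) ∈ ℂ²` with `[ℚ(γ₁, γ₂):ℚ] ≤ d`,
each `γᵢ` a root of a non-zero `Pᵢ ∈ ℤ[X]` of degree `≤ d` and naive height `≤ H`: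
`max(|γ₁ − π|, |γ₂ − e|) ≥ exp(−C(dᵃ log H + dᵇ))`.

THE LINE (card `Ideas/compositum-defect-split.md`, triage r1: 3 × pass; sharpened as the three
triagers asked to the COORDINATEWISE degree split). Write `dᵢ = [ℚ(γᵢ):ℚ] ≤ d` for the true degrees
of the coordinates. The two printed single-variable transcendence measures
(`stub_piTranscendenceMeasure` = Nesterenko–Waldschmidt 1996 Thm 2(2), profile
`d(log H + d log d)(1 + log d)`, and `stub_eTranscendenceMeasure` = ibid. Thm 4(2), profile
`d²(log H + d)`; KNOWN), pushed through the provable transfer "polynomial measure ⇒ point measure in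
TRUE degree with the factor-height slack `+ n`" (`stub_pointMeasure_of_polyMeasure`, via the landed
`EPiSimultaneousType.clause_irreducible`), prove the crux's inequality with exponent
`max(a₁s₁, a₂s₂) < 1` on every challenger with `d₁ ≤ d^{s₁}` OR `d₂ ≤ d^{s₂}` (`s₁ < 1/(1+ε)`,
`s₂ < 1/2`), and on every challenger of small height `log H < d^B` (the `d^b` term absorbs it) —
`crux_of_split`, PROVED here. What is left is the ENTANGLED CORE `stub_entangledCore` (OPEN, the
hardest stub, where all the `e ⊥ π` content of the crux lives): the crux restricted to challengers
with `d₁ > d^{s₁}` (γ₁ nearly generates the common field), `d₂ > d^{s₂}` (so the compositum defect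
`d₁d₂/[ℚ(γ):ℚ] > d^{s₁+s₂−1} ≈ √d`: the two coordinates share most of ONE number field) and
`log H ≥ d^B` (any fixed `B`): a pure large-height simultaneous-exponent statement.
`entangledCore_of_crux` (PROVED) certifies the core is a RESTRICTION of the crux (crux ⟺ inputs ∧ core).

`EPiSimultaneousType_of : EPiSimultaneousType` composes the four stubs into the crux BY NAME
(kernel-checked; `sorry` only inside the four `stub_*`).

## Disproof used (`Cruxes/EPiSimultaneousType/Disproof.lean`, cdisprove cycle 1, NO KILL; read
2026-08-16 — its §0 vocabulary `θ`, `Admissible`, `bound` is COPIED here verbatim so that this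
skeleton does not break when the disprover rewrites its work file)
* §1 `crux_false_without_heightClause` — HONOURED: the line USES the integer-polynomial clause at
  `stub_pointMeasure_of_polyMeasure` (the clause's own `Pᵢ`, degree `n = d`, height `H`, is what the
  single measures are fed, with the `+ n` slack) and `EntangledCore` keeps the full `Admissible`.
* §2 `not_measureAt_liouvillePoint` / `not_forall_transcendental_measure` (a proof must feed
  `(π, e)`-specific Diophantine input) — the inputs are exactly NW1996 Thm 2(2) (π) and Thm 4(2) (e);
  the core is stated at `θ = (π, e)` only. `not_crux_with_neg_exponent` (`a ≥ 0`) and §3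
  `not_crux_half_of_weakAP2` (`a ≥ 1/2` modulo printed AP2) — consistent: the provable half has
  exponent `max((1+ε)s₁, 2s₂) → 1⁻`, the core's window is `[1/2, 1)`.
* `crux_iff_normalised`, `one_le_of_admissible`, `norm_sub_eq_max` — the degenerate corners
  (`d, H ≥ 1`, sup norm) are handled the same way here (`one_le_of_admissible`, `norm_coord_le`).
* LANDED Negative lemmas (`Theorems/EPiSimultaneousType/Negative/*`): no stub is an instance —
  `NegExponentFalse` (a < 0), `LiouvillePointNoMeasure` (other base point), `RaceHalfFalse` /
  `CoordinatewiseLinear` (a < 1/2; common-field clause dropped) are all outside the stubs' ranges;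
  `IrreducibleWitness.clause_irreducible` is the TOOL for stub 3. `-- Targets`: none yet.
* `ledger negatives --problem Schanuel`: the two PolarPhantoms refutations — unrelated.
-/

set_option linter.dupNamespace false
set_option linter.unusedVariables false

noncomputable section

open Polynomial
open scoped IntermediateField

namespace Summit.Schanuel.Schanuel.Cruxes.EPiSimultaneousType.CompositumDefectSplit

open Summit.Schanuel.Schanuel.Theses.DiophantineDichotomy (EPiSimultaneousType)

/-! ## §0 Vocabulary of the crux (verbatim copy of `Disproof.lean` §0) -/

/-- The base point `θ = (π, e) ∈ ℂ²`, exactly as written in the crux. -/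
def θ : Fin 2 → ℂ := ![(Real.pi : ℂ), (Real.exp 1 : ℂ)]

/-- The per-coordinate clause of the crux: `z` is a root of a non-zero integer polynomial of
degree `≤ n` and naive height `≤ H`. -/
def Clause (n H : ℕ) (z : ℂ) : Prop :=
  ∃ P : Polynomial ℤ, P ≠ 0 ∧ P.natDegree ≤ n ∧ (∀ k, |P.coeff k| ≤ (H : ℤ)) ∧
    Polynomial.aeval z P = 0

/-- The admissibility clause of the crux for `(d, H, γ)`: `[ℚ(γ):ℚ] ≤ d` and `Clause d H (γ i)`
for both coordinates (same `Prop` as `Disproof.Admissible`). -/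
def Admissible (d H : ℕ) (γ : Fin 2 → ℂ) : Prop :=
  Module.finrank ℚ ↥(IntermediateField.adjoin ℚ (Set.range γ)) ≤ d ∧ ∀ i, Clause d H (γ i)

/-- The lower bound `exp(−C(dᵃ log H + dᵇ))` of the crux. -/
def bound (a b C : ℝ) (d H : ℕ) : ℝ :=
  Real.exp (-(C * ((d : ℝ) ^ a * Real.log H + (d : ℝ) ^ b)))

/-- The TRUE degree `[ℚ(z):ℚ]` of a complex number (`0` if `z` is transcendental; `≥ 1` and `≤ n`
under `Clause n H z`, see `finrank_bounds_of_clause`). -/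
def deg (z : ℂ) : ℕ := Module.finrank ℚ ↥ℚ⟮z⟯

/-- The crux READ BACK in this vocabulary (its normal form; `crux_iff`): `∃ a < 1, b, C > 0, ∀ d H γ,
Admissible d H γ → bound a b C d H ≤ ‖γ − θ‖`. Intermediate results of this file conclude `CruxNF`;
only `EPiSimultaneousType_of` concludes the route decl by name. -/
def CruxNF : Prop :=
  ∃ a b C : ℝ, a < 1 ∧ 0 < C ∧ ∀ (d H : ℕ) (γ : Fin 2 → ℂ), Admissible d H γ → bound a b C d H ≤ ‖γ - θ‖

/-- READ-BACK: the crux is literally `CruxNF`. [folklore] -/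
theorem crux_iff : EPiSimultaneousType ↔ CruxNF := by
  simp only [EPiSimultaneousType, CruxNF, Admissible, Clause, bound, θ, and_imp]

/-! ## §1 The single-variable inputs (statements) -/

/-- **Transcendence measure of `π` of Fel'dman type** — the printed profile of
Nesterenko–Waldschmidt 1996, Thm 2(2) (arXiv:math/0002047 p. 1: for `P ∈ ℤ[x]`, `P ≠ 0`,
`deg P ≤ d`, `L(P) ≤ L`, `L ≥ 3`: `|P(π)| ≥ exp{−2·10⁶·d·(log L + d log d)·(1 + log d)}`), written
with the naive height `H` (`L(P) ≤ (d+1)H`, `log max(3,(d+1)H) + d log d ≤ log H + 2d(1 + log d)`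
for `d ≥ 1`, so `c = 4·10⁶` works) : `|P(π)| ≥ exp(−c·d·(log H + d(1 + log d))·(1 + log d))`. -/
def PiTranscendenceMeasure : Prop :=
  ∃ c : ℝ, 0 < c ∧ ∀ (d H : ℕ) (P : Polynomial ℤ), 1 ≤ d → P ≠ 0 → P.natDegree ≤ d →
    (∀ k, |P.coeff k| ≤ (H : ℤ)) →
      Real.exp (-(c * d * (Real.log H + d * (1 + Real.log d)) * (1 + Real.log d))) ≤
        ‖Polynomial.aeval (Real.pi : ℂ) P‖

/-- **Transcendence measure of `e`** — the printed profile of Nesterenko–Waldschmidt 1996, Thm 4(2)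
(arXiv:math/0002047 p. 1: `|P(e)| ≥ exp{−1.3·10⁵·d²·(log L + d)}` for `deg P ≤ d`, `L(P) ≤ L`,
`L ≥ 3`), with the naive height (`log L + d ≤ log H + 4d` for `d ≥ 1`, so `c = 5.2·10⁵` works):
`|P(e)| ≥ exp(−c·d²·(log H + d))`. Degree exponent `2` (e is VALUE-side in the Gel'fond–Laurent
method); a uniform exponent `< 2` for `e` is NOT in print (Popken–Mahler give type 1 only for
`log log H ≫ d² log d`, Bugeaud 2004 p. 83) — see the line card, "upgrade path". -/
def ETranscendenceMeasure : Prop :=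
  ∃ c : ℝ, 0 < c ∧ ∀ (d H : ℕ) (P : Polynomial ℤ), 1 ≤ d → P ≠ 0 → P.natDegree ≤ d →
    (∀ k, |P.coeff k| ≤ (H : ℤ)) →
      Real.exp (-(c * (d : ℝ) ^ 2 * (Real.log H + d))) ≤ ‖Polynomial.aeval (Real.exp 1 : ℂ) P‖

/-- A POLYNOMIAL measure for `ξ` in the crux's template: degree exponent `a`, free `b`:
`|P(ξ)| ≥ exp(−C(dᵃ log H + dᵇ))` for non-zero `P ∈ ℤ[X]` of degree `≤ d` (`d ≥ 1`) and naive
height `≤ H`. (`PiTranscendenceMeasure ⇒ PolyMeasure π (1+ε)` for every `ε > 0` and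
`ETranscendenceMeasure ⇒ PolyMeasure e 2` are PROVED below.) -/
def PolyMeasure (ξ : ℂ) (a : ℝ) : Prop :=
  ∃ b C : ℝ, 0 < C ∧ ∀ (d H : ℕ) (P : Polynomial ℤ), 1 ≤ d → P ≠ 0 → P.natDegree ≤ d →
    (∀ k, |P.coeff k| ≤ (H : ℤ)) →
      Real.exp (-(C * ((d : ℝ) ^ a * Real.log H + (d : ℝ) ^ b))) ≤ ‖Polynomial.aeval ξ P‖

/-- A POINT measure for `ξ` in TRUE-DEGREE currency: for `γ` satisfying the crux's clause with
polynomial degree bound `n` and height `H`, `|γ − ξ| ≥ exp(−C([ℚ(γ):ℚ]ᵃ·(log H + n) + nᵇ))`.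
The point is that the exponent `a` acts on the true degree `deg γ ≤ n`, not on `n`; the slack `+ n`
pays for passing from the given `P` to the minimal polynomial of `γ` (height `≤ 8ⁿH`, landed
`EPiSimultaneousType.clause_irreducible`) — necessary: height-`3` β-expansion polynomials of degree
`n` have roots within `4π^{−n}` of `π`. -/
def PointMeasure (ξ : ℂ) (a : ℝ) : Prop :=
  ∃ b C : ℝ, 0 < C ∧ ∀ (n H : ℕ) (γ : ℂ), Clause n H γ →
    Real.exp (-(C * ((deg γ : ℝ) ^ a * (Real.log H + n) + (n : ℝ) ^ b))) ≤ ‖γ - ξ‖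

/-! ## §2 The entangled core (statement) -/

/-- **The entangled core of the crux at thresholds `(s₁, s₂)`**: the crux's conclusion, with its
own `∃ a < 1, b, C > 0` and extra free largeness parameters `B` and `d₀`, demanded ONLY of
admissible challengers `γ` with `d ≥ d₀`, `[ℚ(γ₁):ℚ] > d^{s₁}`, `[ℚ(γ₂):ℚ] > d^{s₂}` and
`log H ≥ d^B` — an ASYMPTOTIC (in `d`), LARGE-HEIGHT simultaneous-exponent statement. For
`s₁ → 1⁻`, `s₂ → (1/2)⁻` this is exactly the population the known single-variable measures cannot
reach (`crux_of_split`); on it `γ₁` generates a subfield of index `< d^{1−s₁}` in `ℚ(γ₁, γ₂)` and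
the compositum defect `d₁d₂/[ℚ(γ):ℚ]` exceeds `d^{s₁+s₂−1}`. A RESTRICTION of the crux
(`entangledCore_of_crux`). -/
def EntangledCore (s₁ s₂ : ℝ) : Prop :=
  ∃ (a b B C : ℝ) (d₀ : ℕ), a < 1 ∧ 0 < C ∧ ∀ (d H : ℕ) (γ : Fin 2 → ℂ), Admissible d H γ →
    d₀ ≤ d → (d : ℝ) ^ s₁ < deg (γ 0) → (d : ℝ) ^ s₂ < deg (γ 1) → (d : ℝ) ^ B ≤ Real.log H →
      bound a b C d H ≤ ‖γ - θ‖

/-! ## §3 The four stubs -/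

/-- **Stub 1 — transcendence measure of `π`** (`PiTranscendenceMeasure`; KNOWN in print:
Nesterenko–Waldschmidt 1996 Thm 2(2) = Waldschmidt 1978 / Fel'dman; size L: lands as a named
Literature fact + the `L ↔ H` bookkeeping in the docstring of the statement). Why it might fail: it
does not at truth level (transcription risk only: `L` = length, `L ≥ 3`, `deg P ≤ d`). -/
theorem stub_piTranscendenceMeasure : PiTranscendenceMeasure := by
  sorry

/-- **Stub 2 — transcendence measure of `e`** (`ETranscendenceMeasure`; KNOWN in print:
Nesterenko–Waldschmidt 1996 Thm 4(2); size L: named Literature fact + bookkeeping). Why it might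
fail: it does not at truth level. -/
theorem stub_eTranscendenceMeasure : ETranscendenceMeasure := by
  sorry

/-- **Stub 3 — polynomial measure ⇒ point measure in true degree** (PROVABLE NOW, size M): for
every `ξ ∈ ℂ` and `a ≥ 0`, `PolyMeasure ξ a → PointMeasure ξ a`. Proof sketch: given `Clause n H γ`,
the landed `EPiSimultaneousType.clause_irreducible` yields an irreducible `Q ∈ ℤ[X]` with
`deg Q = [ℚ(γ):ℚ] =: δ ≤ n`, height `≤ 8ⁿH`, `Q(γ) = 0`; apply the polynomial measure to `Q` at
degree `δ`: `|Q(ξ)| ≥ exp(−C(δᵃ(log H + n log 8) + δᵇ))`; if `|γ − ξ| ≥ 1` the claim is trivial,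
else `|Q(ξ)| = |Q(ξ) − Q(γ)| ≤ |ξ − γ|·δ²·8ⁿH·(|ξ| + 2)^δ`; absorb using `δᵃ ≥ 1` (`a ≥ 0`),
`δ ≤ n`, `b ↦ max b 1`. Why it might fail: it does not (elementary); Lean debt = a mean-value /
difference bound for integer polynomials on a disc and `rpow` bookkeeping. -/
theorem stub_pointMeasure_of_polyMeasure :
    ∀ (ξ : ℂ) (a : ℝ), 0 ≤ a → PolyMeasure ξ a → PointMeasure ξ a := by
  sorry

/-- **Stub 4 — THE ENTANGLED CORE** (OPEN — the lever's residual, HARDEST; the lead holds this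
one): for SOME thresholds `s₁ < 1`, `s₂ < 1/2`, `EntangledCore s₁ s₂`. Why plausibly true: it is
implied by the crux (a restriction of it), and the crux is what genericity predicts at a point of
transcendence degree `2` (exponent `1/2 + o(1)`, Disproof WHY-IT-RESISTS (3)). Why it might fail /
resist: with `ApproximationPropertyDegOne` (known) it implies `e ⊥ π` (`EPiRace`,
Disproof `epiRace_kernel`), and every known measure architecture at `(1, iπ)` is Young-equivalent to
the Liouville floor `exp(−C d log H)` (barrier `LargeTranscendenceDegree`); a kill would be a family
of number fields `K_d` of degree `d → ∞` carrying generators `γ₁ → π`, `γ₂ → e` of quality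
`H^{−ω(d)}`, `ω(d) ≥ d^{1−o(1)}` (curve-like behaviour of `(π, e)`). -/
theorem stub_entangledCore : ∃ s₁ s₂ : ℝ, s₁ < 1 ∧ s₂ < 1 / 2 ∧ EntangledCore s₁ s₂ := by
  sorry

/-! ## §4 Elementary facts about the clause (PROVED) -/

/-- The clause forces `d ≥ 1` and `H ≥ 1` (a non-zero integer polynomial with a complex root is
non-constant and has a non-zero coefficient). [folklore] -/
theorem one_le_of_clause {d H : ℕ} {z : ℂ} (h : Clause d H z) : 1 ≤ d ∧ 1 ≤ H := by
  obtain ⟨P, hP0, hdeg, hH, hroot⟩ := h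
  constructor
  · by_contra hd
    have hd0 : P.natDegree = 0 := by omega
    rw [Polynomial.eq_C_of_natDegree_eq_zero hd0] at hroot
    simp at hroot
    apply hP0
    rw [Polynomial.eq_C_of_natDegree_eq_zero hd0, hroot, map_zero]
  · by_contra hH0
    have : H = 0 := by omega
    subst this
    apply hP0
    ext k
    have := hH k
    simp only [CharP.cast_eq_zero, abs_nonpos_iff] at this
    simp [this]

/-- `Admissible ⇒ d ≥ 1 ∧ H ≥ 1`. [folklore] -/
theorem one_le_of_admissible {d H : ℕ} {γ : Fin 2 → ℂ} (h : Admissible d H γ) : 1 ≤ d ∧ 1 ≤ H :=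
  one_le_of_clause (h.2 0)

/-- Under the clause the true degree satisfies `1 ≤ deg z ≤ n`. [folklore] -/
theorem finrank_bounds_of_clause {z : ℂ} {n H : ℕ} (h : Clause n H z) : 1 ≤ deg z ∧ deg z ≤ n := by
  obtain ⟨P, hP0, hdeg, -, hroot⟩ := h
  set Q : ℚ[X] := P.map (algebraMap ℤ ℚ) with hQ
  have hQ0 : Q ≠ 0 := (Polynomial.map_ne_zero_iff (algebraMap ℤ ℚ).injective_int).mpr hP0
  have hQroot : Polynomial.aeval z Q = 0 := by rw [hQ, Polynomial.aeval_map_algebraMap]; exact hroot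
  have hint : IsIntegral ℚ z := isAlgebraic_iff_isIntegral.mp ⟨Q, hQ0, hQroot⟩
  unfold deg
  rw [IntermediateField.adjoin.finrank hint]
  refine ⟨minpoly.natDegree_pos hint, ?_⟩
  calc (minpoly ℚ z).natDegree ≤ Q.natDegree :=
        Polynomial.natDegree_le_natDegree (minpoly.degree_le_of_ne_zero ℚ z hQ0 hQroot)
    _ = P.natDegree := Polynomial.natDegree_map_eq_of_injective (algebraMap ℤ ℚ).injective_int P
    _ ≤ n := hdeg

/-- The sup norm dominates each coordinate: `‖γ i − θ i‖ ≤ ‖γ − θ‖`. [folklore] -/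
theorem norm_coord_le (γ : Fin 2 → ℂ) (i : Fin 2) : ‖γ i - θ i‖ ≤ ‖γ - θ‖ := by
  have h := norm_le_pi_norm (γ - θ) i
  simpa only [Pi.sub_apply] using h

theorem theta_zero : θ 0 = (Real.pi : ℂ) := rfl

theorem theta_one : θ 1 = (Real.exp 1 : ℂ) := rfl

/-! ## §5 From the printed profiles to the template (PROVED) -/

/-- `PiTranscendenceMeasure ⇒ PolyMeasure π (1 + ε)` for every `ε > 0`: `1 + log d ≤ (1 + ε⁻¹)dᵋ`
(`log d ≤ dᵋ/ε`), so `d(log H + d(1 + log d))(1 + log d) ≤ k d^{1+ε} log H + k² d^{2+2ε}`,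
`k = 1 + ε⁻¹`. [folklore] -/
theorem polyMeasure_pi_of_transcendenceMeasure (h : PiTranscendenceMeasure) {ε : ℝ} (hε : 0 < ε) :
    PolyMeasure (Real.pi : ℂ) (1 + ε) := by
  obtain ⟨c, hc, h⟩ := h
  set k : ℝ := 1 + ε⁻¹ with hk
  have hεinv : 0 < ε⁻¹ := inv_pos.mpr hε
  have hk1 : 1 ≤ k := by rw [hk]; linarith
  refine ⟨2 + 2 * ε, c * k ^ 2, by positivity, ?_⟩
  intro d H P hd hP0 hdeg hH
  refine le_trans (Real.exp_le_exp.mpr (neg_le_neg ?_)) (h d H P hd hP0 hdeg hH)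
  have hD : (1 : ℝ) ≤ d := by exact_mod_cast hd
  have hD0 : (0 : ℝ) < d := by linarith
  have hL : 0 ≤ Real.log H := Real.log_natCast_nonneg H
  have hlogd : 0 ≤ Real.log d := Real.log_nonneg hD
  set X : ℝ := (d : ℝ) ^ ε with hX
  have hX1 : 1 ≤ X := Real.one_le_rpow hD hε.le
  have hlog : 1 + Real.log d ≤ k * X := by
    have h1 : Real.log d ≤ X / ε := Real.log_le_rpow_div hD0.le hε
    have h2 : X / ε = ε⁻¹ * X := by rw [div_eq_inv_mul]
    rw [hk]
    nlinarith
  have e1 : (d : ℝ) * X = (d : ℝ) ^ (1 + ε) := by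
    rw [hX, Real.rpow_add hD0, Real.rpow_one]
  have e2 : (d : ℝ) * d * (X * X) = (d : ℝ) ^ (2 + 2 * ε) := by
    have : (2 : ℝ) + 2 * ε = 2 + (ε + ε) := by ring
    rw [hX, this, Real.rpow_add hD0, Real.rpow_add hD0, Real.rpow_two]
    ring
  have hkX : 0 ≤ k * X := by positivity
  calc c * d * (Real.log H + d * (1 + Real.log d)) * (1 + Real.log d)
      ≤ c * d * (Real.log H + d * (k * X)) * (k * X) := by
        have hx : Real.log H + d * (1 + Real.log d) ≤ Real.log H + d * (k * X) := by
          linarith [mul_le_mul_of_nonneg_left hlog hD0.le]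
        apply mul_le_mul _ hlog (by positivity) (by positivity)
        exact mul_le_mul_of_nonneg_left hx (by positivity)
    _ = c * k * ((d : ℝ) * X) * Real.log H + c * k ^ 2 * ((d : ℝ) * d * (X * X)) := by ring
    _ = c * k * (d : ℝ) ^ (1 + ε) * Real.log H + c * k ^ 2 * (d : ℝ) ^ (2 + 2 * ε) := by
        rw [e1, e2]
    _ ≤ c * k ^ 2 * (d : ℝ) ^ (1 + ε) * Real.log H + c * k ^ 2 * (d : ℝ) ^ (2 + 2 * ε) := by
        have hkk : k ≤ k ^ 2 := by nlinarith
        have hp : 0 ≤ (d : ℝ) ^ (1 + ε) * Real.log H := by positivity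
        nlinarith [mul_le_mul_of_nonneg_right hkk (mul_nonneg hc.le hp)]
    _ = c * k ^ 2 * ((d : ℝ) ^ (1 + ε) * Real.log H + (d : ℝ) ^ (2 + 2 * ε)) := by ring

/-- `ETranscendenceMeasure ⇒ PolyMeasure e 2` (`b = 3`: `c d²(log H + d) = c(d² log H + d³)`).
[folklore] -/
theorem polyMeasure_e_of_transcendenceMeasure (h : ETranscendenceMeasure) :
    PolyMeasure (Real.exp 1 : ℂ) 2 := by
  obtain ⟨c, hc, h⟩ := h
  refine ⟨3, c, hc, ?_⟩
  intro d H P hd hP0 hdeg hH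
  refine le_trans (le_of_eq ?_) (h d H P hd hP0 hdeg hH)
  have e2 : (d : ℝ) ^ (2 : ℝ) = (d : ℝ) ^ (2 : ℕ) := by exact_mod_cast Real.rpow_natCast (d : ℝ) 2
  have e3 : (d : ℝ) ^ (3 : ℝ) = (d : ℝ) ^ (3 : ℕ) := by exact_mod_cast Real.rpow_natCast (d : ℝ) 3
  rw [e2, e3]
  ring_nf

/-! ## §6 The core is a restriction of the crux (PROVED) -/

/-- `EPiSimultaneousType ⇒ EntangledCore s₁ s₂` for all thresholds (forget the extra hypotheses).
So the core is WEAKER than the crux: the split is an honest normal form, not a costume. [folklore] -/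
theorem entangledCore_of_crux (h : EPiSimultaneousType) (s₁ s₂ : ℝ) : EntangledCore s₁ s₂ := by
  have h' : CruxNF := crux_iff.mp h
  obtain ⟨a, b, C, ha, hC, h⟩ := h'
  exact ⟨a, b, 0, C, 0, ha, hC, fun d H γ hadm _ _ _ _ => h d H γ hadm⟩

/-! ## §7 The composition (PROVED): point measures for `π` and `e` + the core ⟹ the crux -/

/-- **The degree-structure split.** If `π` has a point measure with degree exponent `a₁ ≥ 0`, `e` one
with exponent `a₂ ≥ 0`, and the entangled core holds at thresholds `(s₁, s₂)` with `a₁s₁ < 1`,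
`a₂s₂ < 1`, then the crux (`CruxNF ⟺ EPiSimultaneousType`) holds, with
`a = max(a₁s₁, a₂s₂, a_core, 0) < 1`. Cases for an admissible `(d, H, γ)` (`dᵢ = [ℚ(γᵢ):ℚ]`):
(O) `d < D₀ = max(d₀, 1)`: the `π`-measure at coordinate `0` gives `C₁K(log H + 1)`,
`K = D₀^{a₁} + D₀^{a₁+1} + D₀^{|b₁|}`, absorbed by the constant `C ≥ C₁K`;
(A) `d₁ ≤ d^{s₁}`: the `π`-measure at coordinate `0` with the crux's own polynomial (`n = d`) gives
`C₁(d₁^{a₁}(log H + d) + d^{b₁}) ≤ C₁(dᵃ log H + d^{a+1} + d^{b₁})`; (B) `d₂ ≤ d^{s₂}`: the same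
with `e`; (C) `log H < d^{B⁺}`: the `π`-measure gives a bound free of `log H`, absorbed by `dᵇ`;
(D) otherwise the core applies and the bound only weakens as `a, b, C` grow. [folklore] -/
theorem crux_of_split {a₁ a₂ s₁ s₂ : ℝ} (ha₁ : 0 ≤ a₁) (ha₂ : 0 ≤ a₂)
    (h₁ : a₁ * s₁ < 1) (h₂ : a₂ * s₂ < 1)
    (hπ : PointMeasure (Real.pi : ℂ) a₁) (he : PointMeasure (Real.exp 1 : ℂ) a₂)
    (hcore : EntangledCore s₁ s₂) : CruxNF := by
  obtain ⟨b₁, C₁, hC₁, hπ⟩ := hπ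
  obtain ⟨b₂, C₂, hC₂, he⟩ := he
  obtain ⟨a₀, b₀, B, C₀, d₀, ha₀, hC₀, hcore⟩ := hcore
  unfold CruxNF
  -- the witnesses
  set a : ℝ := max (max (a₁ * s₁) (a₂ * s₂)) (max a₀ 0) with ha_def
  set B' : ℝ := max B 0 with hB'_def
  set b : ℝ := |b₁| + |b₂| + |b₀| + a₁ + a₂ + B' + 2 with hb_def
  set D₀ : ℝ := max (d₀ : ℝ) 1 with hD₀_def
  have hD₀1 : 1 ≤ D₀ := le_max_right _ _
  have hD₀0 : 0 < D₀ := lt_of_lt_of_le one_pos hD₀1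
  set K : ℝ := D₀ ^ a₁ + D₀ ^ (a₁ + 1) + D₀ ^ |b₁| with hK_def
  have hKa : D₀ ^ a₁ ≤ K := by
    have h1 : 0 ≤ D₀ ^ (a₁ + 1) := Real.rpow_nonneg hD₀0.le _
    have h2 : 0 ≤ D₀ ^ |b₁| := Real.rpow_nonneg hD₀0.le _
    rw [hK_def]; linarith
  have hKb : D₀ ^ (a₁ + 1) + D₀ ^ |b₁| ≤ K := by
    have h1 : 0 ≤ D₀ ^ a₁ := Real.rpow_nonneg hD₀0.le _
    rw [hK_def]; linarith
  have hK1 : 1 ≤ K := by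
    have h1 : 1 ≤ D₀ ^ a₁ := Real.one_le_rpow hD₀1 ha₁
    have h2 : 0 ≤ D₀ ^ (a₁ + 1) := Real.rpow_nonneg hD₀0.le _
    have h3 : 0 ≤ D₀ ^ |b₁| := Real.rpow_nonneg hD₀0.le _
    rw [hK_def]; linarith
  set C : ℝ := 3 * (C₁ + C₂ + C₀) * K with hC_def
  have hCK : 3 * (C₁ + C₂ + C₀) ≤ C := by
    rw [hC_def]
    have h0 : 0 ≤ 3 * (C₁ + C₂ + C₀) := by positivity
    nlinarith
  have ha0 : 0 ≤ a := le_trans (le_max_right a₀ 0) (le_max_right _ _)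
  have ha1 : a < 1 := by
    simp only [ha_def, max_lt_iff]
    exact ⟨⟨h₁, h₂⟩, ha₀, one_pos⟩
  have hB'0 : 0 ≤ B' := le_max_right _ _
  have hb₁ : b₁ ≤ b := by
    have := le_abs_self b₁; have := abs_nonneg b₂; have := abs_nonneg b₀; linarith
  have hb₂ : b₂ ≤ b := by
    have := le_abs_self b₂; have := abs_nonneg b₁; have := abs_nonneg b₀; linarith
  have hb₀ : b₀ ≤ b := by
    have := le_abs_self b₀; have := abs_nonneg b₁; have := abs_nonneg b₂; linarith
  have hab : a + 1 ≤ b := by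
    have := abs_nonneg b₁; have := abs_nonneg b₂; have := abs_nonneg b₀; linarith
  have ha₁B : a₁ + B' ≤ b := by
    have := abs_nonneg b₁; have := abs_nonneg b₂; have := abs_nonneg b₀; linarith
  have ha₁1 : a₁ + 1 ≤ b := by
    have := abs_nonneg b₁; have := abs_nonneg b₂; have := abs_nonneg b₀; linarith
  have hC₁C : 3 * C₁ ≤ C := by linarith
  have hC₂C : 3 * C₂ ≤ C := by linarith
  have hC₀C : C₀ ≤ C := by linarith
  have hC₁K : C₁ * K ≤ C := by
    rw [hC_def]
    have h0 : 0 ≤ K := by linarith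
    nlinarith
  refine ⟨a, b, C, ha1, by positivity, ?_⟩
  intro d H γ hadm
  obtain ⟨hd1, hH1⟩ := one_le_of_admissible hadm
  have hD : (1 : ℝ) ≤ d := by exact_mod_cast hd1
  have hD0 : (0 : ℝ) < d := by linarith
  have hL : 0 ≤ Real.log H := Real.log_natCast_nonneg H
  have hmono : ∀ {x y : ℝ}, x ≤ y → (d : ℝ) ^ x ≤ (d : ℝ) ^ y := fun hxy =>
    Real.rpow_le_rpow_of_exponent_le hD hxy
  have hda : 0 ≤ (d : ℝ) ^ a := Real.rpow_nonneg hD0.le a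
  have hdb : 0 ≤ (d : ℝ) ^ b := Real.rpow_nonneg hD0.le b
  -- COVER: a coordinate whose single measure is good enough settles the challenger
  have cover : ∀ (i : Fin 2) {Cᵢ aᵢ bᵢ : ℝ}, 0 < Cᵢ → 3 * Cᵢ ≤ C → bᵢ ≤ b →
      Real.exp (-(Cᵢ * ((deg (γ i) : ℝ) ^ aᵢ * (Real.log H + d) + (d : ℝ) ^ bᵢ))) ≤ ‖γ i - θ i‖ →
      (deg (γ i) : ℝ) ^ aᵢ * (Real.log H + d) ≤ (d : ℝ) ^ a * Real.log H + 2 * (d : ℝ) ^ b →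
      bound a b C d H ≤ ‖γ - θ‖ := by
    intro i Cᵢ aᵢ bᵢ hCᵢ hCᵢC hbᵢ hmeas hkey
    refine le_trans ?_ (hmeas.trans (norm_coord_le γ i))
    apply Real.exp_le_exp.mpr
    apply neg_le_neg
    have hbi : (d : ℝ) ^ bᵢ ≤ (d : ℝ) ^ b := hmono hbᵢ
    calc Cᵢ * ((deg (γ i) : ℝ) ^ aᵢ * (Real.log H + d) + (d : ℝ) ^ bᵢ)
        ≤ Cᵢ * (((d : ℝ) ^ a * Real.log H + 2 * (d : ℝ) ^ b) + (d : ℝ) ^ b) := by gcongr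
      _ = (3 * Cᵢ) * ((d : ℝ) ^ b) + Cᵢ * ((d : ℝ) ^ a * Real.log H) := by ring
      _ ≤ C * ((d : ℝ) ^ b) + C * ((d : ℝ) ^ a * Real.log H) := by
          gcongr
          linarith
      _ = C * ((d : ℝ) ^ a * Real.log H + (d : ℝ) ^ b) := by ring
  -- the true degrees of the coordinates
  have hdeg0 := finrank_bounds_of_clause (hadm.2 0)
  have hdeg1 := finrank_bounds_of_clause (hadm.2 1)
  have hδ0 : (0 : ℝ) ≤ deg (γ 0) := by positivity
  have hδ1 : (0 : ℝ) ≤ deg (γ 1) := by positivity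
  have hδ0d : (deg (γ 0) : ℝ) ≤ d := by exact_mod_cast hdeg0.2
  have hδ1d : (deg (γ 1) : ℝ) ≤ d := by exact_mod_cast hdeg1.2
  -- the two single measures at the crux's own polynomials (n = d)
  have mπ := hπ d H (γ 0) (hadm.2 0)
  have me := he d H (γ 1) (hadm.2 1)
  rw [← theta_zero] at mπ
  rw [← theta_one] at me
  have hdab : (d : ℝ) ^ a * d ≤ (d : ℝ) ^ b := by
    rw [← Real.rpow_add_one hD0.ne' a]; exact hmono hab
  have hda1 : 1 ≤ (d : ℝ) ^ a := Real.one_le_rpow hD ha0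
  have hdb1 : 1 ≤ (d : ℝ) ^ b := Real.one_le_rpow hD (by linarith)
  by_cases hO : (d : ℝ) < D₀
  · -- Case O: bounded degree d < D₀ — the π-measure on coordinate 0, absorbed by the constant
    refine le_trans ?_ (mπ.trans (norm_coord_le γ 0))
    apply Real.exp_le_exp.mpr
    apply neg_le_neg
    have e1 : (deg (γ 0) : ℝ) ^ a₁ ≤ D₀ ^ a₁ := Real.rpow_le_rpow hδ0 (hδ0d.trans hO.le) ha₁
    have e2 : (d : ℝ) ^ b₁ ≤ D₀ ^ |b₁| :=
      (hmono (le_abs_self b₁)).trans (Real.rpow_le_rpow hD0.le hO.le (abs_nonneg b₁))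
    have e3 : D₀ ^ a₁ * D₀ = D₀ ^ (a₁ + 1) := by rw [Real.rpow_add_one hD₀0.ne']
    have hDa : 0 ≤ D₀ ^ a₁ := Real.rpow_nonneg hD₀0.le _
    calc C₁ * ((deg (γ 0) : ℝ) ^ a₁ * (Real.log H + d) + (d : ℝ) ^ b₁)
        ≤ C₁ * (D₀ ^ a₁ * (Real.log H + D₀) + D₀ ^ |b₁|) := by gcongr
      _ = C₁ * (D₀ ^ a₁ * Real.log H + (D₀ ^ a₁ * D₀ + D₀ ^ |b₁|)) := by ring
      _ = C₁ * (D₀ ^ a₁ * Real.log H + (D₀ ^ (a₁ + 1) + D₀ ^ |b₁|)) := by rw [e3]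
      _ ≤ C₁ * (K * Real.log H + K) := by gcongr
      _ = (C₁ * K) * (1 * Real.log H + 1) := by ring
      _ ≤ C * ((d : ℝ) ^ a * Real.log H + (d : ℝ) ^ b) := by gcongr
  have hd₀ : d₀ ≤ d := by
    have h : (d₀ : ℝ) ≤ d := le_trans (le_max_left _ _) (not_lt.mp hO)
    exact_mod_cast h
  by_cases hA : (deg (γ 0) : ℝ) ≤ (d : ℝ) ^ s₁
  · -- Case A: the π-measure on coordinate 0
    refine cover 0 hC₁ hC₁C hb₁ mπ ?_
    have e1 : (deg (γ 0) : ℝ) ^ a₁ ≤ (d : ℝ) ^ a := by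
      calc (deg (γ 0) : ℝ) ^ a₁ ≤ ((d : ℝ) ^ s₁) ^ a₁ := Real.rpow_le_rpow hδ0 hA ha₁
        _ = (d : ℝ) ^ (s₁ * a₁) := (Real.rpow_mul hD0.le s₁ a₁).symm
        _ ≤ (d : ℝ) ^ a := hmono (by rw [mul_comm]; exact le_trans (le_max_left _ _) (le_max_left _ _))
    calc (deg (γ 0) : ℝ) ^ a₁ * (Real.log H + d) ≤ (d : ℝ) ^ a * (Real.log H + d) := by gcongr
      _ = (d : ℝ) ^ a * Real.log H + (d : ℝ) ^ a * d := by ring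
      _ ≤ (d : ℝ) ^ a * Real.log H + 2 * (d : ℝ) ^ b := by linarith
  by_cases hB : (deg (γ 1) : ℝ) ≤ (d : ℝ) ^ s₂
  · -- Case B: the e-measure on coordinate 1
    refine cover 1 hC₂ hC₂C hb₂ me ?_
    have e1 : (deg (γ 1) : ℝ) ^ a₂ ≤ (d : ℝ) ^ a := by
      calc (deg (γ 1) : ℝ) ^ a₂ ≤ ((d : ℝ) ^ s₂) ^ a₂ := Real.rpow_le_rpow hδ1 hB ha₂
        _ = (d : ℝ) ^ (s₂ * a₂) := (Real.rpow_mul hD0.le s₂ a₂).symm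
        _ ≤ (d : ℝ) ^ a := hmono (by rw [mul_comm]; exact le_trans (le_max_right _ _) (le_max_left _ _))
    calc (deg (γ 1) : ℝ) ^ a₂ * (Real.log H + d) ≤ (d : ℝ) ^ a * (Real.log H + d) := by gcongr
      _ = (d : ℝ) ^ a * Real.log H + (d : ℝ) ^ a * d := by ring
      _ ≤ (d : ℝ) ^ a * Real.log H + 2 * (d : ℝ) ^ b := by linarith
  by_cases hC : Real.log H < (d : ℝ) ^ B'
  · -- Case C: small height — the π-measure on coordinate 0, no `log H` needed
    refine cover 0 hC₁ hC₁C hb₁ mπ ?_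
    have e1 : (deg (γ 0) : ℝ) ^ a₁ ≤ (d : ℝ) ^ a₁ := Real.rpow_le_rpow hδ0 hδ0d ha₁
    have e2 : (d : ℝ) ^ a₁ * (d : ℝ) ^ B' ≤ (d : ℝ) ^ b := by
      rw [← Real.rpow_add hD0]; exact hmono ha₁B
    have e3 : (d : ℝ) ^ a₁ * d ≤ (d : ℝ) ^ b := by
      rw [← Real.rpow_add_one hD0.ne' a₁]; exact hmono ha₁1
    have hda₁ : 0 ≤ (d : ℝ) ^ a₁ := Real.rpow_nonneg hD0.le a₁
    calc (deg (γ 0) : ℝ) ^ a₁ * (Real.log H + d) ≤ (d : ℝ) ^ a₁ * ((d : ℝ) ^ B' + d) := by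
          gcongr
      _ = (d : ℝ) ^ a₁ * (d : ℝ) ^ B' + (d : ℝ) ^ a₁ * d := by ring
      _ ≤ (d : ℝ) ^ b + (d : ℝ) ^ b := add_le_add e2 e3
      _ = 0 + 2 * (d : ℝ) ^ b := by ring
      _ ≤ (d : ℝ) ^ a * Real.log H + 2 * (d : ℝ) ^ b := by gcongr; positivity
  · -- Case D: the entangled core
    simp only [not_le, not_lt] at hA hB hC
    have hBB : (d : ℝ) ^ B ≤ Real.log H := le_trans (hmono (le_max_left B 0)) hC
    have key := hcore d H γ hadm hd₀ hA hB hBB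
    refine le_trans ?_ key
    -- monotonicity of the bound in (a, b, C)
    unfold bound
    apply Real.exp_le_exp.mpr
    apply neg_le_neg
    have h1 : (d : ℝ) ^ a₀ ≤ (d : ℝ) ^ a := hmono (le_trans (le_max_left a₀ 0) (le_max_right _ _))
    have h2 : (d : ℝ) ^ b₀ ≤ (d : ℝ) ^ b := hmono hb₀
    have h3 : 0 ≤ (d : ℝ) ^ a * Real.log H + (d : ℝ) ^ b := by positivity
    calc C₀ * ((d : ℝ) ^ a₀ * Real.log H + (d : ℝ) ^ b₀)
        ≤ C₀ * ((d : ℝ) ^ a * Real.log H + (d : ℝ) ^ b) := by gcongr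
      _ ≤ C * ((d : ℝ) ^ a * Real.log H + (d : ℝ) ^ b) := by gcongr

/-! ## §8 The crux from the line -/

/-- **The crux from the line** — the ONLY theorem of this file concluding
`Summit.Schanuel.Schanuel.Theses.DiophantineDichotomy.EPiSimultaneousType`, BY NAME; no hypotheses,
the four registered stubs are INVOKED (sorries live only in `stub_*`). Chain: stubs 1, 2 (printed
profiles) ⟹ `PolyMeasure π (1+ε)`, `PolyMeasure e 2` (`polyMeasure_*_of_transcendenceMeasure`,
proved) ⟹ point measures (stub 3) ⟹ with the core (stub 4, thresholds `s₁ < 1`, `s₂ < 1/2`;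
`ε = (1 − s₁)/2` makes `(1+ε)s₁ < 1`, and `2s₂ < 1`) the crux (`crux_of_split`, proved). -/
theorem EPiSimultaneousType_of : EPiSimultaneousType := by
  obtain ⟨s₁, s₂, hs₁, hs₂, hcore⟩ := stub_entangledCore
  have hε : 0 < (1 - s₁) / 2 := by linarith
  have h₁ : (1 + (1 - s₁) / 2) * s₁ < 1 := by
    nlinarith [mul_pos (show (0 : ℝ) < 1 - s₁ by linarith) (show (0 : ℝ) < 2 - s₁ by linarith)]
  have h₂ : (2 : ℝ) * s₂ < 1 := by linarith
  exact crux_iff.mpr <| crux_of_split (by linarith) (by norm_num) h₁ h₂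
    (stub_pointMeasure_of_polyMeasure _ _ (by linarith)
      (polyMeasure_pi_of_transcendenceMeasure stub_piTranscendenceMeasure hε))
    (stub_pointMeasure_of_polyMeasure _ _ (by norm_num)
      (polyMeasure_e_of_transcendenceMeasure stub_eTranscendenceMeasure))
    hcore

/-- **Upgrade path, kernel-checked** (not a registered stub): a point measure for `e` with degree
exponent `1 + ε` for every `ε > 0` ("uniform type one for `e`", NOT in print — Popken–Mahler give it
only for `log log H ≫ d² log d`) would move the `e`-threshold from `1/2` to `1`: the crux (`CruxNF`)
would then follow from the core at ANY thresholds `s₁, s₂ < 1`, i.e. from the crux restricted to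
challengers both of whose coordinates have degree `> d^{1−o(1)}`. -/
theorem crux_of_typeOne_e (hπ : ∀ ε : ℝ, 0 < ε → PointMeasure (Real.pi : ℂ) (1 + ε))
    (he : ∀ ε : ℝ, 0 < ε → PointMeasure (Real.exp 1 : ℂ) (1 + ε))
    {s₁ s₂ : ℝ} (hs₁ : s₁ < 1) (hs₂ : s₂ < 1) (hcore : EntangledCore s₁ s₂) :
    CruxNF := by
  have hε₁ : 0 < (1 - s₁) / 2 := by linarith
  have hε₂ : 0 < (1 - s₂) / 2 := by linarith
  have h₁ : (1 + (1 - s₁) / 2) * s₁ < 1 := by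
    nlinarith [mul_pos (show (0 : ℝ) < 1 - s₁ by linarith) (show (0 : ℝ) < 2 - s₁ by linarith)]
  have h₂ : (1 + (1 - s₂) / 2) * s₂ < 1 := by
    nlinarith [mul_pos (show (0 : ℝ) < 1 - s₂ by linarith) (show (0 : ℝ) < 2 - s₂ by linarith)]
  exact crux_of_split (by linarith) (by linarith) h₁ h₂ (hπ _ hε₁) (he _ hε₂) hcore

end Summit.Schanuel.Schanuel.Cruxes.EPiSimultaneousType.CompositumDefectSplit

end
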